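/-
Copyright: rh-split cell (screw, bridge) gen 14, 2026-08-27.  Splitting search over kernel-typed
RH-equivalences.  A splitting `A ∧ B ⟹ RH` is CONDITIONAL bookkeeping unless `A` and `B` are both
proved; nothing here bears on the truth of RH.
-/
import Summits.RiemannHypothesis.RiemannHypothesis.Theorems.Splittings.ScrewLatticeSupB2
import HarnessLib

/-!
# Row X-8‴ — `MaxRe ∧ SEF(h) ⟺ RH` (sub-exponential lattice FLOOR)

For a step `h > 0` let

* `MaxRe` := `∃ ρ₀ ∈ 𝒩, ∀ ρ ∈ 𝒩, Re ρ ≤ Re ρ₀` (the supremum `Θ` of the real parts of the non-trivial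
  zeros is a maximum — Ingham's hypothesis; RH-implied by Hardy, `ScrewLatticeSup.maxRe_of_rh`);
* `SEF(h)` := `∀ η > 0, ∃ K, ∀ k : ℕ, -K·e^{η k h} ≤ Ψ(k h)` (a SUB-EXPONENTIAL FLOOR for the screw
  function `Ψ = zetaScrew` sampled on the lattice `hℕ`; strictly weaker, as a hypothesis, than the
  bounded floor `LAT(h)` of row X-8′ `ScrewLatticeSup.maxRe_and_latticePos_iff_rh` and than lattice
  positivity; RH-implied by Suzuki 2023 Thm 1.7, `ZetaScrewThm17.zetaScrew_nonneg_of_RH`).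

Then `MaxRe ∧ SEF(h) ⟺ RH` (`maxRe_and_subexpFloor_iff_rh`).  The direction `⟹` is the tree's
attained graded dictionary `ScrewLatticeSup.quasiRH_iff_supAttainedOrLe_and_latticeFloor` at EVERY
level `η > 0` (with `B = Re ρ₀ - 1/2` attained), followed by `ScrewGradedFloor.rh_of_forall_quasiRH`.
The RH-free content is the dichotomy `subexpFloor_dichotomy`: `SEF(h) ⟹ (RH ∨ ¬MaxRe)`, i.e. a
sub-exponential lattice floor alone already forces «`Θ` attained ⟹ `Θ = 1/2`».

No `sorry`, no new axioms, no instances, no notation.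
-/

set_option linter.dupNamespace false

namespace Summit.RiemannHypothesis.RiemannHypothesis.Theorems.Splittings.ScrewLatticeSubexp

open Literature.NumberTheory.LFunctions
open ZetaZeros.riemannZetaNontrivialZeros
open Summit.RiemannHypothesis.RiemannHypothesis.Theorems.Splittings

/-- **MaxRe ∧ SEF(h) ⟹ RH.**  If the supremum of the real parts of the non-trivial zeros is attained and
`Ψ` has a sub-exponential floor on the lattice `hℕ` (`h > 0`), then the Riemann hypothesis holds. -/
theorem rh_of_maxRe_of_subexpFloor {h : ℝ} (hh : 0 < h)
    (hmax : ∃ ρ₀ : ℂ, ρ₀ ∈ ZetaZeros.riemannZetaNontrivialZeros ∧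
      ∀ ρ : ℂ, ρ ∈ ZetaZeros.riemannZetaNontrivialZeros → ρ.re ≤ ρ₀.re)
    (hsef : ∀ η : ℝ, 0 < η → ∃ K : ℝ, ∀ k : ℕ, -K * Real.exp (η * (k * h)) ≤ zetaScrew (k * h)) :
    RiemannHypothesis := by
  obtain ⟨ρ₀, hρ₀, hmax⟩ := hmax
  -- the maximal real part is `≥ 1/2` (symmetry `ρ ↦ 1 - conj ρ`)
  have hge : 1 / 2 ≤ ρ₀.re := by
    have h1 := hmax _ (one_sub_conj_mem hρ₀)
    simp only [Complex.sub_re, Complex.one_re, Complex.conj_re] at h1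
    linarith
  -- every offset is bounded by the attained offset `B = Re ρ₀ - 1/2`
  have hB : ∀ ρ : ℂ, ρ ∈ ZetaZeros.riemannZetaNontrivialZeros →
      |ρ.re - 1 / 2| ≤ |ρ₀.re - 1 / 2| := by
    intro ρ hρ
    rw [abs_of_nonneg (by linarith : 0 ≤ ρ₀.re - 1 / 2), abs_le]
    have h1 := hmax ρ hρ
    have h2 := hmax _ (one_sub_conj_mem hρ)
    simp only [Complex.sub_re, Complex.one_re, Complex.conj_re] at h2
    constructor <;> linarith
  refine ScrewGradedFloor.rh_of_forall_quasiRH fun η hη ↦ ?_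
  exact (ScrewLatticeSup.quasiRH_iff_supAttainedOrLe_and_latticeFloor hh hη.le).2
    ⟨⟨|ρ₀.re - 1 / 2|, hB, Or.inr ⟨ρ₀, hρ₀, rfl⟩⟩, hsef η hη⟩

/-- Under RH the lattice samples have the trivial sub-exponential floor `K = 0` (`Ψ ≥ 0`, Suzuki Thm 1.7). -/
theorem subexpFloor_of_rh (hRH : RiemannHypothesis) (h : ℝ) :
    ∀ η : ℝ, 0 < η → ∃ K : ℝ, ∀ k : ℕ, -K * Real.exp (η * (k * h)) ≤ zetaScrew (k * h) :=
  fun _ _ ↦ ⟨0, fun k ↦ by simpa using ZetaScrewThm17.zetaScrew_nonneg_of_RH hRH (k * h)⟩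

/-- **ROW X-8‴ (the splitting)**, `h > 0` arbitrary:
`(∃ ρ₀ ∈ 𝒩, ∀ ρ ∈ 𝒩, Re ρ ≤ Re ρ₀) ∧ (∀ η > 0, ∃ K, ∀ k ∈ ℕ, -K e^{η k h} ≤ Ψ(k h)) ↔ RiemannHypothesis`. -/
theorem maxRe_and_subexpFloor_iff_rh {h : ℝ} (hh : 0 < h) :
    ((∃ ρ₀ : ℂ, ρ₀ ∈ ZetaZeros.riemannZetaNontrivialZeros ∧
        ∀ ρ : ℂ, ρ ∈ ZetaZeros.riemannZetaNontrivialZeros → ρ.re ≤ ρ₀.re) ∧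
      ∀ η : ℝ, 0 < η → ∃ K : ℝ, ∀ k : ℕ, -K * Real.exp (η * (k * h)) ≤ zetaScrew (k * h)) ↔
      RiemannHypothesis :=
  ⟨fun hab ↦ rh_of_maxRe_of_subexpFloor hh hab.1 hab.2,
    fun hRH ↦ ⟨ScrewLatticeSup.maxRe_of_rh hRH, subexpFloor_of_rh hRH h⟩⟩

/-- **RH-free dichotomy.**  A sub-exponential lattice floor alone gives: RH, or the supremum of the real
parts of the zeros is NOT attained (`SEF(h) ⟹ RH ∨ ¬MaxRe`). -/
theorem subexpFloor_dichotomy {h : ℝ} (hh : 0 < h)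
    (hsef : ∀ η : ℝ, 0 < η → ∃ K : ℝ, ∀ k : ℕ, -K * Real.exp (η * (k * h)) ≤ zetaScrew (k * h)) :
    RiemannHypothesis ∨
      ¬ ∃ ρ₀ : ℂ, ρ₀ ∈ ZetaZeros.riemannZetaNontrivialZeros ∧
        ∀ ρ : ℂ, ρ ∈ ZetaZeros.riemannZetaNontrivialZeros → ρ.re ≤ ρ₀.re := by
  by_cases hmax : ∃ ρ₀ : ℂ, ρ₀ ∈ ZetaZeros.riemannZetaNontrivialZeros ∧
      ∀ ρ : ℂ, ρ ∈ ZetaZeros.riemannZetaNontrivialZeros → ρ.re ≤ ρ₀.re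
  · exact Or.inl (rh_of_maxRe_of_subexpFloor hh hmax hsef)
  · exact Or.inr hmax

/-- The sub-exponential lattice floor is implied by the bounded lattice floor of row X-8′ (`h ≥ 0`; so
X-8‴ has the formally weaker `B`-conjunct). -/
theorem subexpFloor_of_latticeFloor {h : ℝ} (hh : 0 ≤ h)
    (hfloor : ∃ K : ℝ, ∀ k : ℕ, -K ≤ zetaScrew (k * h)) :
    ∀ η : ℝ, 0 < η → ∃ K : ℝ, ∀ k : ℕ, -K * Real.exp (η * (k * h)) ≤ zetaScrew (k * h) := by
  intro η hη
  obtain ⟨K, hK⟩ := hfloor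
  refine ⟨max K 0, fun k ↦ ?_⟩
  have hK0 : 0 ≤ max K 0 := le_max_right _ _
  have harg : 0 ≤ η * (k * h) := by positivity
  have h1 : 1 ≤ Real.exp (η * (k * h)) := Real.one_le_exp harg
  calc -(max K 0) * Real.exp (η * (k * h)) ≤ -(max K 0) * 1 := by nlinarith
    _ ≤ -K := by simp
    _ ≤ zetaScrew (k * h) := hK k

/-! ## Row X-8⁗: the EVENTUAL STRIP replaces MaxRe

`ES` := for every `η > 0` only finitely many non-trivial zeros have `|Re ρ - 1/2| ≥ η` (verbatim the tree's
`BombieriTruncBandGap.EventualStrip`, kept import-free here): RH-implied, implied by FOZ, and compatible with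
infinitely many off-line zeros accumulating toward the line.  At each level `η > 0` the finitely many zeros
beyond `η` make the supremum attained-or-`≤ η` (`ScrewLatticeSup.supAttainedOrLe_of_cofiniteStrip`), the graded
dictionary gives quasi-RH at `1/2 + η`, and `η → 0`. -/

/-- **ES ∧ SEF(h) ⟹ RH** (`h > 0`). -/
theorem rh_of_eventualStrip_of_subexpFloor {h : ℝ} (hh : 0 < h)
    (hES : ∀ η : ℝ, 0 < η →
      {ρ : ℂ | ρ ∈ ZetaZeros.riemannZetaNontrivialZeros ∧ η ≤ |ρ.re - 1 / 2|}.Finite)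
    (hsef : ∀ η : ℝ, 0 < η → ∃ K : ℝ, ∀ k : ℕ, -K * Real.exp (η * (k * h)) ≤ zetaScrew (k * h)) :
    RiemannHypothesis := by
  refine ScrewGradedFloor.rh_of_forall_quasiRH fun η hη ↦ ?_
  have hfin : {ρ : ℂ | ρ ∈ ZetaZeros.riemannZetaNontrivialZeros ∧ η < |ρ.re - 1 / 2|}.Finite :=
    (hES η hη).subset fun ρ hρ ↦ ⟨hρ.1, hρ.2.le⟩
  exact (ScrewLatticeSup.quasiRH_iff_supAttainedOrLe_and_latticeFloor hh hη.le).2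
    ⟨ScrewLatticeSup.supAttainedOrLe_of_cofiniteStrip hfin, hsef η hη⟩

/-- RH ⟹ ES (vacuously: every zero is on the line). -/
theorem eventualStrip_of_rh (hRH : RiemannHypothesis) :
    ∀ η : ℝ, 0 < η →
      {ρ : ℂ | ρ ∈ ZetaZeros.riemannZetaNontrivialZeros ∧ η ≤ |ρ.re - 1 / 2|}.Finite := by
  intro η hη
  have hq : QuasiRiemannHypothesis (1 / 2 + 0) := by
    rw [add_zero]; exact quasiRiemannHypothesis_one_half_iff_holds.2 hRH
  convert Set.finite_empty
  ext ρ
  simp only [Set.mem_setOf_eq, Set.mem_empty_iff_false, iff_false, not_and]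
  intro hρ hle
  have := ScrewGradedFloor.strip_of_quasiRH hq ρ hρ
  linarith

/-- **ROW X-8⁗**, `h > 0` arbitrary: `ES ∧ SEF(h) ↔ RiemannHypothesis`. -/
theorem eventualStrip_and_subexpFloor_iff_rh {h : ℝ} (hh : 0 < h) :
    ((∀ η : ℝ, 0 < η →
        {ρ : ℂ | ρ ∈ ZetaZeros.riemannZetaNontrivialZeros ∧ η ≤ |ρ.re - 1 / 2|}.Finite) ∧
      ∀ η : ℝ, 0 < η → ∃ K : ℝ, ∀ k : ℕ, -K * Real.exp (η * (k * h)) ≤ zetaScrew (k * h)) ↔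
      RiemannHypothesis :=
  ⟨fun hab ↦ rh_of_eventualStrip_of_subexpFloor hh hab.1 hab.2,
    fun hRH ↦ ⟨eventualStrip_of_rh hRH, subexpFloor_of_rh hRH h⟩⟩

/-- RH-free: a sub-exponential lattice floor gives RH, or infinitely many zeros beyond some strip
`|Re ρ - 1/2| ≥ η > 0` (`SEF(h) ⟹ RH ∨ ¬ES`). -/
theorem subexpFloor_dichotomy_strip {h : ℝ} (hh : 0 < h)
    (hsef : ∀ η : ℝ, 0 < η → ∃ K : ℝ, ∀ k : ℕ, -K * Real.exp (η * (k * h)) ≤ zetaScrew (k * h)) :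
    RiemannHypothesis ∨ ¬ ∀ η : ℝ, 0 < η →
      {ρ : ℂ | ρ ∈ ZetaZeros.riemannZetaNontrivialZeros ∧ η ≤ |ρ.re - 1 / 2|}.Finite := by
  by_cases hES : ∀ η : ℝ, 0 < η →
      {ρ : ℂ | ρ ∈ ZetaZeros.riemannZetaNontrivialZeros ∧ η ≤ |ρ.re - 1 / 2|}.Finite
  · exact Or.inl (rh_of_eventualStrip_of_subexpFloor hh hES hsef)
  · exact Or.inr hES

/-! ## The sub-exponential CEILING (two-sided growth) and complementarity with row X-9

`CEIL(h)` := `∀ ε > 0, ∃ K, ∀ k, |Ψ(k h)| ≤ K e^{ε k}` (verbatim `ScrewLatticeContinuation.LatticeCeiling h`, kept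
import-free here).  Two-sided sub-exponential growth trivially gives the one-sided floor `SEF(h)`, so
`MaxRe ∧ CEIL(h) ⟺ RH` as well, and `CEIL(h) ⟹ RH ∨ ¬MaxRe`.  Together with row X-9's dichotomy
(`CEIL(h) ⟹ RH ∨ ¬CC(h)`, module `ScrewLatticeContinuation`) this reads: `CEIL(h) ∧ ¬RH` forces BOTH a
non-attained supremum of `Re ρ` AND an aliased pole field with uncountable closure. -/

/-- `CEIL(h) ⟹ SEF(h)` (`h > 0`). -/
theorem subexpFloor_of_latticeCeiling {h : ℝ} (hh : 0 < h)
    (hceil : ∀ ε : ℝ, 0 < ε → ∃ K : ℝ, ∀ k : ℕ, |zetaScrew (k * h)| ≤ K * Real.exp (ε * k)) :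
    ∀ η : ℝ, 0 < η → ∃ K : ℝ, ∀ k : ℕ, -K * Real.exp (η * (k * h)) ≤ zetaScrew (k * h) := by
  intro η hη
  obtain ⟨K, hK⟩ := hceil (η * h) (by positivity)
  refine ⟨K, fun k ↦ ?_⟩
  have h1 := hK k
  have h2 := neg_abs_le (zetaScrew (k * h))
  have h3 : η * h * (k : ℝ) = η * (k * h) := by ring
  rw [h3] at h1
  linarith

/-- **`MaxRe ∧ CEIL(h) ⟺ RH`** (`h > 0`): the two-sided companion of row X-8‴. -/
theorem maxRe_and_latticeCeiling_iff_rh {h : ℝ} (hh : 0 < h) :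
    ((∃ ρ₀ : ℂ, ρ₀ ∈ ZetaZeros.riemannZetaNontrivialZeros ∧
        ∀ ρ : ℂ, ρ ∈ ZetaZeros.riemannZetaNontrivialZeros → ρ.re ≤ ρ₀.re) ∧
      ∀ ε : ℝ, 0 < ε → ∃ K : ℝ, ∀ k : ℕ, |zetaScrew (k * h)| ≤ K * Real.exp (ε * k)) ↔
      RiemannHypothesis := by
  refine ⟨fun hab ↦ rh_of_maxRe_of_subexpFloor hh hab.1 (subexpFloor_of_latticeCeiling hh hab.2),
    fun hRH ↦ ⟨ScrewLatticeSup.maxRe_of_rh hRH, fun ε hε ↦ ?_⟩⟩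
  set C : ℝ := ∑' ρ : ZetaZeros.riemannZetaNontrivialZeros,
    2 * (riemannZetaZeroOrder (ρ : ℂ) : ℝ) / (ρ : ℂ).im ^ 2 with hC
  have hb : ∀ t : ℝ, |zetaScrew t| ≤ C := fun t ↦ ZetaScrewGrowth.abs_zetaScrew_le_of_RH hRH t
  have h0 : 0 ≤ C := (abs_nonneg _).trans (hb 0)
  refine ⟨C, fun k ↦ (hb (k * h)).trans ?_⟩
  have h1 : 1 ≤ Real.exp (ε * k) := Real.one_le_exp (by positivity)
  nlinarith

/-- RH-free: `CEIL(h) ⟹ RH ∨ ¬MaxRe` (`h > 0`). -/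
theorem latticeCeiling_dichotomy_maxRe {h : ℝ} (hh : 0 < h)
    (hceil : ∀ ε : ℝ, 0 < ε → ∃ K : ℝ, ∀ k : ℕ, |zetaScrew (k * h)| ≤ K * Real.exp (ε * k)) :
    RiemannHypothesis ∨
      ¬ ∃ ρ₀ : ℂ, ρ₀ ∈ ZetaZeros.riemannZetaNontrivialZeros ∧
        ∀ ρ : ℂ, ρ ∈ ZetaZeros.riemannZetaNontrivialZeros → ρ.re ≤ ρ₀.re :=
  subexpFloor_dichotomy hh (subexpFloor_of_latticeCeiling hh hceil)

end Summit.RiemannHypothesis.RiemannHypothesis.Theorems.Splittings.ScrewLatticeSubexp
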